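import Mathlib

/-!
# The typed parent conjecture `SqrtAffineChowla₂` of the strategy census is false as stated

Crux `FanDecorrelation` (`Summit.Parity.GeneralizedHardyLittlewood.Theses.LiouvilleMAD`, stmt-Parity-13318).
The crux strategist's census (`Cruxes/FanDecorrelation/STRATEGY-CENSUS.md`, heading STRENGTHEN S1, typed in
`Cruxes/FanDecorrelation/StrategyCensus.lean` as `StrategyCensus.SqrtAffineChowla₂`) names as "the honest PARENT
CONJECTURE" of the crux: for every `ε > 0`, `A` there is `C` such that for all boxes `(x₀,x₀+X] × (y₀,y₀+Y]`,
`X, Y ≤ N`, and all pairs of affine forms `ψ_i = a_i x + b_i y + c_i` of height `≤ N^A` with NON-PROPORTIONAL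
LINEAR PARTS (`a₁b₂ ≠ a₂b₁`), positive on the box, `|Σ_box λ(ψ₁)λ(ψ₂)| ≤ C·√(XY)·N^ε`.

This file records (line lead c5, 2026-08-17) that the statement is FALSE AS TYPED (`not_sqrtAffineChowla₂`):
non-proportionality of the LINEAR parts does not prevent the two forms from COINCIDING on a row of the box.
Witness: `ψ₁ = x + 1` (`(a₁,b₁,c₁) = (1,0,1)`), `ψ₂ = x + y` (`(a₂,b₂,c₂) = (1,1,0)`), `a₁b₂ − a₂b₁ = 1 ≠ 0`,
box `(0, X] × (0, 1]` (the single row `y = 1`, on which `ψ₁ = ψ₂ = x + 1`), `N = X = k⁴`, `ε = 1/4`, `A = 1`: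
the sum is `Σ_{x=1}^{X} λ(x+1)² = X = k⁴` exactly, while the bound is `C·√X·X^{1/4} = C·k³ < k⁴` for `k > C`.
(The census docstring's remark "`Y = 1` … gives only the trivial bound there" is the slip: at `Y = 1` the typed
bound is `C√X·N^ε`, not trivial.)  With `Y` rows the same pair gives `X + Σ_{y=2}^{Y} Σ_x λ(x+1)λ(x+y)`, so under
the random model the statement fails for every box with `Y ≤ X^{1−3ε}` containing the degenerate row; an
unconditional refutation with `Y > 1` would need two-point Chowla bounds for the other rows, hence `Y = 1` here.

REPAIR (information for planners; not asserted): add the hypothesis that the box contains NO row and NO column on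
which the two forms are proportional as polynomials in the remaining variable, i.e.
`∀ y ∈ (y₀,y₀+Y], a₁(b₂y + c₂) ≠ a₂(b₁y + c₁)` and `∀ x ∈ (x₀,x₀+X], b₁(a₂x + c₂) ≠ b₂(a₁x + c₁)` (given
`a₁b₂ ≠ a₂b₁` there is at most one such row and one such column in ℤ²).  The crux instance survives the repair:
in the variables `(m, j)` its forms are `nm + c` and `n'm − n'kj + c`; a degenerate row `j*` needs
`n n' k j* = c(n − n')`, i.e. `|c| ≥ n'|k|Q > Q`, impossible once `M ≥ c²` (this is the disprover's
`proportional_lag_small`), and a degenerate column needs `nm + c = 0`, where `λ(0) = 0` anyway.  The repaired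
statement is random-model consistent and still implies the crux (ϑ = 1/8 + 2ε via j-blocks of width `M^{1/4}`);
it remains, like the crux, far beyond every known method (it contains square-root two-point Chowla).

The definition below is a VERBATIM copy of `StrategyCensus.SqrtAffineChowla₂` (StrategyCensus.lean lines 60–71),
which lives in a crux work file that is not an importable module; `¬ StrategyCensus.SqrtAffineChowla₂` follows by
`Iff.rfl` transport wherever that file is in scope.
-/

namespace Summit.Parity.GeneralizedHardyLittlewood.Cruxes.FanDecorrelation.SqrtAffineChowlaTwoFalse

open Finset ArithmeticFunction

noncomputable section

/-- VERBATIM copy of `StrategyCensus.SqrtAffineChowla₂` (the census's typed STRENGTHEN S1). -/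
def SqrtAffineChowla₂ : Prop :=
  ∀ ε : ℝ, 0 < ε → ∀ A : ℝ, ∃ C : ℝ, ∀ N X Y : ℕ, 1 ≤ N → X ≤ N → Y ≤ N →
    ∀ x₀ y₀ a₁ b₁ c₁ a₂ b₂ c₂ : ℤ,
      |x₀| ≤ (N : ℝ) ^ A → |y₀| ≤ (N : ℝ) ^ A →
      |a₁| ≤ (N : ℝ) ^ A → |b₁| ≤ (N : ℝ) ^ A → |c₁| ≤ (N : ℝ) ^ A →
      |a₂| ≤ (N : ℝ) ^ A → |b₂| ≤ (N : ℝ) ^ A → |c₂| ≤ (N : ℝ) ^ A →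
      a₁ * b₂ ≠ a₂ * b₁ →
      (∀ x ∈ Ioc x₀ (x₀ + X), ∀ y ∈ Ioc y₀ (y₀ + Y), 0 < a₁ * x + b₁ * y + c₁ ∧ 0 < a₂ * x + b₂ * y + c₂) →
        |∑ x ∈ Ioc x₀ (x₀ + X), ∑ y ∈ Ioc y₀ (y₀ + Y),
            (ArithmeticFunction.liouville (Int.toNat (a₁ * x + b₁ * y + c₁)) : ℝ) *
              (ArithmeticFunction.liouville (Int.toNat (a₂ * x + b₂ * y + c₂)) : ℝ)| ≤
          C * Real.sqrt ((X : ℝ) * Y) * (N : ℝ) ^ ε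

/-- `λ(t)² = 1` for `t ≠ 0` (real-valued). -/
theorem liouville_sq_cast {t : ℕ} (ht : t ≠ 0) :
    (liouville t : ℝ) * (liouville t : ℝ) = 1 := by
  rw [liouville_apply ht]; push_cast
  rw [← pow_add, ← two_mul, pow_mul]; norm_num

/-- The degenerate row: on `(0, X] × (0, 1]` the forms `x + 0·y + 1` and `x + y + 0` coincide, so the
correlation sum equals the number of terms, `X`. -/
theorem degenerate_row_sum (X : ℕ) :
    ∑ x ∈ Ioc (0 : ℤ) (0 + X), ∑ y ∈ Ioc (0 : ℤ) (0 + (1 : ℕ)),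
      (liouville (Int.toNat (1 * x + 0 * y + 1)) : ℝ) * (liouville (Int.toNat (1 * x + 1 * y + 0)) : ℝ) =
        X := by
  have hIoc : Ioc (0 : ℤ) (0 + (1 : ℕ)) = {1} := by
    ext y
    simp only [Nat.cast_one, zero_add, mem_Ioc, mem_singleton]
    omega
  rw [hIoc]
  simp only [sum_singleton, one_mul, zero_mul, add_zero]
  have hterm : ∀ x ∈ Ioc (0 : ℤ) (0 + X),
      (liouville (Int.toNat (x + 1)) : ℝ) * (liouville (Int.toNat (x + 1)) : ℝ) = 1 := by
    intro x hx
    rw [mem_Ioc] at hx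
    apply liouville_sq_cast
    omega
  rw [sum_congr rfl hterm, sum_const, nsmul_eq_mul, mul_one, Int.card_Ioc]
  simp

/-- **`SqrtAffineChowla₂` is false as typed** (degenerate-row witness `ψ₁ = x + 1`, `ψ₂ = x + y` on
`(0, k⁴] × (0, 1]`, `ε = 1/4`, `A = 1`). -/
theorem not_sqrtAffineChowla₂ : ¬ SqrtAffineChowla₂ := by
  intro h
  obtain ⟨C, hC⟩ := h (1 / 4) (by norm_num) 1
  set k : ℕ := ⌈|C|⌉₊ + 1 with hk
  have hk1 : 1 ≤ k := by omega
  have hkC : C < k := by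
    have h1 : |C| ≤ ⌈|C|⌉₊ := Nat.le_ceil _
    have h2 : ((⌈|C|⌉₊ + 1 : ℕ) : ℝ) = (⌈|C|⌉₊ : ℝ) + 1 := by push_cast; ring
    rw [hk, h2]
    linarith [le_abs_self C]
  set X : ℕ := k ^ 4 with hX
  have hX1 : 1 ≤ X := Nat.one_le_pow _ _ hk1
  have hN : ((X : ℕ) : ℝ) ^ (1 : ℝ) = X := Real.rpow_one _
  have hXr1 : (1 : ℝ) ≤ X := by exact_mod_cast hX1
  have hb0 : |(0 : ℤ)| ≤ ((X : ℕ) : ℝ) ^ (1 : ℝ) := by rw [hN]; simp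
  have hb1 : |(1 : ℤ)| ≤ ((X : ℕ) : ℝ) ^ (1 : ℝ) := by rw [hN]; simpa using hXr1
  have hmain := hC X X 1 hX1 le_rfl hX1 0 0 1 0 1 1 1 0 hb0 hb0 hb1 hb0 hb1 hb1 hb1 hb0 (by norm_num)
    (by
      intro x hx y hy
      rw [mem_Ioc] at hx hy
      constructor <;> omega)
  rw [degenerate_row_sum X] at hmain
  -- `hmain : |X| ≤ C * √(X * 1) * X ^ (1/4)`; with `X = k⁴`: `k⁴ ≤ C * k² * k`.
  have hXk : ((X : ℕ) : ℝ) = (k : ℝ) ^ 4 := by rw [hX]; push_cast; ring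
  have hk0 : (0 : ℝ) ≤ k := Nat.cast_nonneg _
  have hsqrt : Real.sqrt (((X : ℕ) : ℝ) * ((1 : ℕ) : ℝ)) = (k : ℝ) ^ 2 := by
    rw [Nat.cast_one, mul_one, hXk, show (k : ℝ) ^ 4 = ((k : ℝ) ^ 2) ^ 2 by ring]
    exact Real.sqrt_sq (by positivity)
  have hquart : ((X : ℕ) : ℝ) ^ (1 / 4 : ℝ) = k := by
    rw [hXk, show (1 / 4 : ℝ) = ((4 : ℕ) : ℝ)⁻¹ by norm_num]
    exact Real.pow_rpow_inv_natCast hk0 (by norm_num)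
  rw [hsqrt, hquart, hXk, abs_of_nonneg (by positivity)] at hmain
  -- `k⁴ ≤ C k³` with `k ≥ 1` and `C < k`: contradiction.
  have hk3 : (0 : ℝ) < (k : ℝ) ^ 3 := by positivity
  have hlt : C * (k : ℝ) ^ 2 * k < (k : ℝ) ^ 4 := by
    have : C * (k : ℝ) ^ 2 * k = C * (k : ℝ) ^ 3 := by ring
    rw [this]
    calc C * (k : ℝ) ^ 3 < (k : ℝ) * (k : ℝ) ^ 3 := mul_lt_mul_of_pos_right hkC hk3
      _ = (k : ℝ) ^ 4 := by ring
  linarith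

end

end Summit.Parity.GeneralizedHardyLittlewood.Cruxes.FanDecorrelation.SqrtAffineChowlaTwoFalse
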